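import Summits.PneNP.PneNP.Theorems.ConvexRankGatesCaptureDefs
import Summits.PneNP.PneNP.Theorems.CliqueExtLowerBound.Negative.PermConsequences
import Mathlib.LinearAlgebra.Span.Defs
import Mathlib.Algebra.Module.ZMod
import HarnessLib

/-!
# Crux `Capture` (stmt-PneNP-2659), line `csp-spine-meet-to-join` rev 4 — monotone span programs over
# `𝔽₂` are ONE PERM gate (`span_program_cktSize`)

The circuit plumbing of Stub C (`stub_twoStepCore`): a Boolean function of the selection `v` that fires
iff `(0, 1)` lies in the `𝔽₂`-span of the union of the selected relation blocks `R j ⊆ 𝔽₂^Idx × 𝔽₂` is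
computed by one gate of `permBasis S` as soon as `2 (|Idx| + 1) ≤ S` — the translation-flip action of
`𝔽₂^(Option Idx)` (`abelianProgram_isPermGate`), rows = all relations of all blocks, each owned by the
input of its block. Combined with `twoStep_unsat_iff_span_of` this is Theorem A. Continuation lead c1,
2026-08-16. [folklore]
-/

namespace Summit.PneNP.PneNP.Cruxes.Capture.CspSpineMeetToJoin

set_option linter.dupNamespace false -- `Summit.PneNP.PneNP.…`: summit = sub-problem (D-0017)

open Literature.Computability.Complexity
open Summit.PneNP.PneNP.Theorems.CliqueExtLowerBound.Negative (abelianProgram_isPermGate)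

/-- **Monotone span programs over `𝔽₂` are one PERM gate** (registered sub-goal `span_program_cktSize`):
if `f v = true ↔ (0,1) ∈ span_{𝔽₂} (⋃_{v j = 1} R j)` for relation blocks `R j ⊆ (Idx → 𝔽₂) × 𝔽₂`, then
`f` is computed by one gate of `permBasis S` whenever `2 (|Idx| + 1) ≤ S`. [folklore] -/
theorem span_program_cktSize : ∀ (Idx : Type) [Fintype Idx] (m : ℕ)
    (R : Fin m → Set ((Idx → ZMod 2) × ZMod 2)) (f : (Fin m → Bool) → Bool),
    (∀ v, f v = true ↔ ((0 : Idx → ZMod 2), (1 : ZMod 2)) ∈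
      Submodule.span (ZMod 2) (⋃ j ∈ {j | v j = true}, R j)) →
    ∀ S : ℕ, 2 * (Fintype.card Idx + 1) ≤ S → CktSize (permBasis S) (fun v (_ : Unit) => f v) 1 := by
  intro Idx _ m R f hf S hS
  classical
  -- rows: all relations of all blocks, each owned by its block
  let Row : Type := Σ j : Fin m, {wb : (Idx → ZMod 2) × ZMod 2 // wb ∈ R j}
  let N : ℕ := Fintype.card Row
  let eq : Row ≃ Fin N := Fintype.equivFin Row
  let wire : Fin N → Fin m := fun i => (eq.symm i).1
  -- coordinates `(w, b) ↦ (b, w)` in `Option Idx → ZMod 2`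
  let co : ((Idx → ZMod 2) × ZMod 2) →+ (Option Idx → ZMod 2) :=
    { toFun := fun wb o => Option.elim o wb.2 wb.1
      map_zero' := by funext o; cases o <;> rfl
      map_add' := fun a b => by funext o; cases o <;> rfl }
  have hco : Function.Injective co := fun a b h => by
    have h1 : ∀ o, co a o = co b o := fun o => by rw [h]
    refine Prod.ext (funext fun i => ?_) ?_
    · exact h1 (some i)
    · exact h1 none
  let ρ : Fin N → Option Idx → ZMod 2 := fun i => co (eq.symm i).2.1
  let t : Option Idx → ZMod 2 := co ((0 : Idx → ZMod 2), (1 : ZMod 2))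
  let P : (Fin N → Bool) → Bool := fun u => decide (Multiplicative.ofAdd t ∈
    Subgroup.closure ((fun i => Multiplicative.ofAdd (ρ i)) '' {i | u i = true}))
  have hPB : (⟨N, P⟩ : GateFn) ∈ permBasis S := by
    refine Or.inr ((abelianProgram_isPermGate ρ t P fun u => decide_eq_true_iff).mono ?_)
    rw [Fintype.card_prod, ZMod.card, Fintype.card_option]
    exact hS
  refine (CktSize.gate (B := permBasis S) ⟨N, P⟩ hPB wire).congr fun v _ => ?_
  -- semantics of the gate on the selection `v`
  show P (fun i => v (wire i)) = f v
  have hset : ρ '' {i | v (wire i) = true} = co '' (⋃ j ∈ {j | v j = true}, R j) := by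
    ext y
    simp only [Set.mem_image, Set.mem_setOf_eq, Set.mem_iUnion, exists_prop]
    constructor
    · rintro ⟨i, hi, rfl⟩
      exact ⟨(eq.symm i).2.1, ⟨(eq.symm i).1, hi, (eq.symm i).2.2⟩, rfl⟩
    · rintro ⟨wb, ⟨j, hj, hwb⟩, rfl⟩
      refine ⟨eq ⟨j, wb, hwb⟩, ?_, ?_⟩
      · show v (eq.symm (eq ⟨j, wb, hwb⟩)).1 = true
        rw [Equiv.symm_apply_apply]; exact hj
      · show co (eq.symm (eq ⟨j, wb, hwb⟩)).2.1 = co wb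
        rw [Equiv.symm_apply_apply]
  have hmul : Multiplicative.ofAdd t ∈
      Subgroup.closure ((fun i => Multiplicative.ofAdd (ρ i)) '' {i | v (wire i) = true}) ↔
      t ∈ AddSubgroup.closure (ρ '' {i | v (wire i) = true}) := by
    rw [← Set.image_image Multiplicative.ofAdd ρ, Equiv.image_eq_preimage_symm,
      Multiplicative.ofAdd_symm_eq, ← AddSubgroup.toSubgroup_closure, Multiplicative.mem_toSubgroup,
      toAdd_ofAdd]
  have hspan : ∀ T : Set ((Idx → ZMod 2) × ZMod 2), ∀ y, y ∈ AddSubgroup.closure T ↔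
      y ∈ Submodule.span (ZMod 2) T := fun T y => by
    constructor
    · intro hy
      exact (AddSubgroup.closure_le (K := (Submodule.span (ZMod 2) T).toAddSubgroup)).2
        Submodule.subset_span hy
    · intro hy
      have : Submodule.span (ZMod 2) T ≤ AddSubgroup.toZModSubmodule 2 (AddSubgroup.closure T) :=
        Submodule.span_le.2 (fun z hz => AddSubgroup.subset_closure hz)
      exact this hy
  rw [Bool.eq_iff_iff, hf v]
  simp only [P, decide_eq_true_eq]
  rw [hmul, hset, ← AddMonoidHom.map_closure, AddSubgroup.mem_map_iff_mem hco, hspan]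

end Summit.PneNP.PneNP.Cruxes.Capture.CspSpineMeetToJoin
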